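/-
Copyright (c) 2026 the pub-hodgecm-mathlib formalisation cell (harness21).  Prover seat hodgecm-mathlib-LH4-p01 (g12): road M6 → F5 → dyadic chain of `stub_DyUnramCore` (D-UNR),
site (L2-3) «THE WALL», CM-carrier base of rows 3∕5 and (A3) of CENSUS-L23-CM v1 (LH10-p01 (g12)) — «CM-SHIFT-θ»; 2026-09-03.
-/
import Literature.NumberTheory.Rogawski1990.TypeTwoCayleyShiftCM            -- ★ F0P2-p06 (g10): the σ-fixed pair on the carriers (pattern); brings `endoEmbLocal`, `IsLocalNormPair`, `finGammaTwo`, `finKappaAt` API (★ `coe_endoEmbLocal`, `finKappaAt_eq_ite_of_eigenvector`, `exists_eigenvector_of_finKappaAt_ne_zero`, …)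
import Literature.NumberTheory.Automorphic.MatrixMoebiusShiftHermitian      -- ★ P1 p853610 (LH10-p01 (g12)): `transpose_map_hermitianMoebius_mul_mul` (the hermitian shift preserves the form), `moebius_conj'`
import Literature.NumberTheory.Automorphic.MatrixGenMoebiusShift            -- (this seat, p853671) four-scalar kit: `genMoebius_reindex`, `genMoebius_fromBlocks`, `genMoebius_mulVec_of_eigenvector_ring`, `genMoebius_fin_one_apply`
import Literature.NumberTheory.Rogawski1990.KottwitzSignLocalTransport      -- ★ `conjLocal_conjLocal` (`c ⊗ 1` is an involution of `L ⊗ L⁺_v`)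
import HarnessLib

/-!
# The HERMITIAN Cayley shift on the CM carriers: `(γ_H, δ) ↦ (φ_θ γ_H, φ_θ δ)` exists, `ι_v` commutes with it, matching and `κ_v` are kept (2-free base of organ (I))

Topic `NumberTheory/Rogawski1990`; namespace `Literature.NumberTheory.Rogawski1990`.  THEOREMS ONLY (no definition, no instance, no notation, no named fact, no `sorry`); kernel lane
`--supports stmt-HodgeConjecture-24833`.  Cell `pub/hodgecm-mathlib` (D-0151), crux H413 = `stmt-HodgeConjecture-24833`; road M6 → F5 → the dyadic chain of organ (D-UNR)
`stub_DyUnramCore`, LEVEL TWO, site (L2-3) «THE WALL» = ★ `liftInterior_of_levelTwo` with `h2` deleted.  ★ `TypeTwoCayleyShiftCM` §1–§2 (F0P2-p06 (g10)) moves the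
pair `(γ_H, δ)` by the σ-FIXED Cayley shift `φ_c = ((c+1)·_ + (c−1))((c−1)·_ + (c+1))⁻¹`, whose level bookkeeping needs `|2|_w = 1`.  The 2-free road (LH10-p01 (g12)
MEMO-L23-θSHIFT; P1–P4 ★) uses the HERMITIAN shift `φ_θ(M) = (θ•M + (c−θ)•1)((c−σθ)•M + σθ•1)⁻¹`, `θ + σθ = 1`.  THIS FILE = the carrier-level twins the CM-glue rows 3
(N3 transport), 5 (type-(2) binders) and (A3) (`Δ‴` under the shift) of CENSUS-L23-CM v1 consume BY NAME, stated for FOUR ARBITRARY SCALARS `(a, b ∣ b′, a′)` wherever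
unitarity is not needed (so that both the shift and its inverse `ψ = φ_{a′,−b ∣ −b′,a}` are instances), and for the hermitian pair where it is:
* §1 `exists_unitary_coe_eq_hermitianMoebius` — `φ` of a `U(σ, H)`-point is a `U(σ, H)`-point for the pair `(a, b ∣ σb, σa)`, `σ` an involution (★ P1);
* §2 on `(cmDatum L N H).Local v`: **`exists_local_coe_eq_hermitianMoebius`** (the shifted element exists; `σ = conjLocal`, `σc = c`, pair `(θ, c−θ ∣ c−σθ, σθ)`),
  **`coe_endoEmbLocal_eq_genMoebius`** (`ι_v(γ_H′) = φ(ι_v(γ_H))` for `γ_H′ = (φ g, φ u)` componentwise, four scalars; ★ `genMoebius_reindex` ∘ `genMoebius_fromBlocks`),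
  `isLocalNormPair_of_coe_eq_genMoebius` (matching is kept, ★ P1 `moebius_conj'`), `finGammaTwo_of_coe_eq_genMoebius` (`γ₂′ = (aγ₂ + b)(b′γ₂ + a′)⁻¹`),
  `finKappaAt_of_coe_eq_genMoebius` (`κ_v` is kept: the `γ₂`-eigenvector of `δ` is the `γ₂′`-eigenvector of `δ′`).
Each is ★'s statement∕proof with `(c+1, c−1 ∣ c−1, c+1)` ↦ `(a, b ∣ b′, a′)`; nothing printed is asserted; count-neutral CM glue.
HONEST LABEL: HC_CM is proved only modulo the 7 printed citations (2 remaining: hLiu418 = stmt-HodgeConjecture-24832, h413 = stmt-HodgeConjecture-24833) until rung 0 closes;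
L2-3 stays THE WALL until every row of CENSUS-L23-CM is paid.

## References
* [Rogawski1990] J. D. Rogawski, *Automorphic Representations of Unitary Groups in Three Variables*, Ann. of Math. Stud. 123 (1990): §4.9 Prop. 4.9.1 (b) p. 55; §4.3 p. 43;
  §4.8 Case (a) p. 53; §14.6 p. 242.
* [Kottwitz1986BaseChangeUnits] R. E. Kottwitz, *Base change for unit elements of Hecke algebras*, Compositio Math. 60 (1986): §3.
* [LanglandsShelstad1987] R. P. Langlands, D. Shelstad, *On the definition of transfer factors*, Math. Ann. 278 (1987): §1.3–1.4.
* [Weyl1939] H. Weyl, *The Classical Groups* (1939): Chap. II §10.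
-/

set_option autoImplicit false

noncomputable section

open NumberField IsDedekindDomain Matrix Polynomial
open scoped MatrixGroups WithZero

namespace Literature.NumberTheory.Rogawski1990

open Literature.NumberTheory.Automorphic Literature.NumberTheory.Automorphic.UnitaryGroup Literature.NumberTheory.Automorphic.MoebiusShift
open Literature.NumberTheory.GaloisRepresentations Literature.NumberTheory.NumberFields

/-! ## §1 Generic: the hermitian shift of a `U(σ, H)`-point is a `U(σ, H)`-point -/

section Generic

variable {R : Type*} [CommRing R] {n : Type*} [Fintype n] [DecidableEq n]

/-- **`φ` of a unitary point is a unitary point, hermitian pair**: for an involution `σ`, `x ∈ U(σ, H)`, ANY `a, b`, and `det(σb·x + σa)`, `det(a·x + b)` units, there is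
`y ∈ U(σ, H)` with matrix `(a·x + b)(σb·x + σa)⁻¹` (★ P1 `transpose_map_hermitianMoebius_mul_mul`, `Matrix.nonsingInvUnit`; ★ `exists_unitary_coe_eq_moebius` is the σ-fixed
pair). [cite: Weyl1939, Chap. II §10] [cite: Kottwitz1986BaseChangeUnits, §3] -/
theorem exists_unitary_coe_eq_hermitianMoebius {σ : R →+* R} (hσ : ∀ x, σ (σ x) = x) {H : Matrix n n R} (x : ↥(unitaryGroupOfForm σ H)) (a b : R)
    (hD : IsUnit (σ b • ((x : GL n R) : Matrix n n R) + σ a • (1 : Matrix n n R)).det) (hN : IsUnit (a • ((x : GL n R) : Matrix n n R) + b • (1 : Matrix n n R)).det) :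
    ∃ y : ↥(unitaryGroupOfForm σ H), ((y : GL n R) : Matrix n n R) = (a • ((x : GL n R) : Matrix n n R) + b • 1) * (σ b • ((x : GL n R) : Matrix n n R) + σ a • 1)⁻¹ := by
  have hdet : IsUnit ((a • ((x : GL n R) : Matrix n n R) + b • 1) * (σ b • ((x : GL n R) : Matrix n n R) + σ a • 1)⁻¹).det := by
    rw [Matrix.det_mul]; exact hN.mul (Matrix.isUnit_nonsing_inv_det _ hD)
  refine ⟨⟨Matrix.nonsingInvUnit _ hdet, ?_⟩, rfl⟩
  rw [mem_unitaryGroupOfForm_iff]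
  exact transpose_map_hermitianMoebius_mul_mul σ hσ H _ x.2 a b hD

end Generic

/-! ## §2 On the `cmDatum` carriers: the shifted elements exist, `ι(γ_H′) = φ(ι(γ_H))`, matching and `κ` are kept (four scalars) -/

section Carriers

variable (L : Type) [Field L] [NumberField L] [IsCMField L] (v : HeightOneSpectrum (𝓞 ↥(maximalRealSubfield L)))

/-- **The hermitian-shifted element exists on `U(H)(L⁺_v)`**: for `x ∈ (cmDatum L N H).Local v`, `c ∈ E_v` fixed by `σ = c ⊗ 1`, `θ ∈ E_v`, and both sides invertible, there is
`y ∈ (cmDatum L N H).Local v` with matrix `φ_θ(x) = (θ•x + (c−θ)•1)((c−σθ)•x + σθ•1)⁻¹` (`σ(c−θ) = c − σθ`; §1 with ★ `conjLocal_conjLocal`).  ★ `exists_local_coe_eq_moebius` is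
the σ-fixed pair `(c+1, c−1)`. [cite: Kottwitz1986BaseChangeUnits, §3] [cite: Rogawski1990, §4.9 Prop. 4.9.1 (b) p. 55] -/
theorem exists_local_coe_eq_hermitianMoebius (N : ℕ) (H : Matrix (Fin N) (Fin N) L) (x : (cmDatum L N H).Local v) {c θ : LocalRing L v}
    (hσc : conjLocal L (IsCMField.complexConj L) v c = c)
    (hD : IsUnit ((c - conjLocal L (IsCMField.complexConj L) v θ) • ((x.val : GL (Fin N) (LocalRing L v)).val : Matrix (Fin N) (Fin N) (LocalRing L v)) +
      conjLocal L (IsCMField.complexConj L) v θ • (1 : Matrix (Fin N) (Fin N) (LocalRing L v))).det)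
    (hN : IsUnit (θ • ((x.val : GL (Fin N) (LocalRing L v)).val : Matrix (Fin N) (Fin N) (LocalRing L v)) + (c - θ) • (1 : Matrix (Fin N) (Fin N) (LocalRing L v))).det) :
    ∃ y : (cmDatum L N H).Local v, ((y.val : GL (Fin N) (LocalRing L v)).val : Matrix (Fin N) (Fin N) (LocalRing L v)) =
      (θ • ((x.val : GL (Fin N) (LocalRing L v)).val : Matrix (Fin N) (Fin N) (LocalRing L v)) + (c - θ) • 1) *
        ((c - conjLocal L (IsCMField.complexConj L) v θ) • ((x.val : GL (Fin N) (LocalRing L v)).val : Matrix (Fin N) (Fin N) (LocalRing L v)) +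
          conjLocal L (IsCMField.complexConj L) v θ • 1)⁻¹ := by
  have hσb : conjLocal L (IsCMField.complexConj L) v (c - θ) = c - conjLocal L (IsCMField.complexConj L) v θ := by rw [map_sub, hσc]
  have hD' : IsUnit (conjLocal L (IsCMField.complexConj L) v (c - θ) • ((x.val : GL (Fin N) (LocalRing L v)).val : Matrix (Fin N) (Fin N) (LocalRing L v)) +
      conjLocal L (IsCMField.complexConj L) v θ • (1 : Matrix (Fin N) (Fin N) (LocalRing L v))).det := by rw [hσb]; exact hD
  obtain ⟨y, hy⟩ := exists_unitary_coe_eq_hermitianMoebius (σ := conjLocal L (IsCMField.complexConj L) v) (conjLocal_conjLocal L v) x θ (c - θ) hD' hN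
  exact ⟨y, by rw [hy, hσb]⟩

set_option maxHeartbeats 400000 in
-- the carriers' types are large
/-- **`ι_v(γ_H′) = φ(ι_v(γ_H))`, four scalars**: the endoscopic embedding commutes with the Möbius shift `φ = (a•_ + b•1)(b′•_ + a′•1)⁻¹` applied componentwise
(`ι_v = reindex endoPerm ∘ fromBlocks`; ★ `genMoebius_reindex`, `genMoebius_fromBlocks`).  ★ `coe_endoEmbLocal_eq_moebius` is the pair `(c+1, c−1 ∣ c−1, c+1)`.
[cite: Rogawski1990, §4.8 Case (a) p. 53; §4.9 p. 55] -/
theorem coe_endoEmbLocal_eq_genMoebius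
    (γH γH' : (cmDatum L 2 (Matrix.of fun i j : Fin 2 => if i.val + j.val + 1 = 2 then (1 : L) else 0)).Local v ×
      (cmDatum L 1 (Matrix.of fun i j : Fin 1 => if i.val + j.val + 1 = 1 then (1 : L) else 0)).Local v)
    (a b a' b' : LocalRing L v)
    (h1 : ((γH'.1.val : GL (Fin 2) (LocalRing L v)).val : Matrix (Fin 2) (Fin 2) (LocalRing L v)) =
      (a • ((γH.1.val : GL (Fin 2) (LocalRing L v)).val : Matrix (Fin 2) (Fin 2) (LocalRing L v)) + b • 1) *
        (b' • ((γH.1.val : GL (Fin 2) (LocalRing L v)).val : Matrix (Fin 2) (Fin 2) (LocalRing L v)) + a' • 1)⁻¹)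
    (h2 : ((γH'.2.val : GL (Fin 1) (LocalRing L v)).val : Matrix (Fin 1) (Fin 1) (LocalRing L v)) =
      (a • ((γH.2.val : GL (Fin 1) (LocalRing L v)).val : Matrix (Fin 1) (Fin 1) (LocalRing L v)) + b • 1) *
        (b' • ((γH.2.val : GL (Fin 1) (LocalRing L v)).val : Matrix (Fin 1) (Fin 1) (LocalRing L v)) + a' • 1)⁻¹)
    (hD1 : IsUnit (b' • ((γH.1.val : GL (Fin 2) (LocalRing L v)).val : Matrix (Fin 2) (Fin 2) (LocalRing L v)) + a' • (1 : Matrix (Fin 2) (Fin 2) (LocalRing L v))).det)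
    (hD2 : IsUnit (b' • ((γH.2.val : GL (Fin 1) (LocalRing L v)).val : Matrix (Fin 1) (Fin 1) (LocalRing L v)) + a' • (1 : Matrix (Fin 1) (Fin 1) (LocalRing L v))).det) :
    (((endoEmbLocal L v γH').val : GL (Fin 3) (LocalRing L v)).val : Matrix (Fin 3) (Fin 3) (LocalRing L v)) =
      (a • (((endoEmbLocal L v γH).val : GL (Fin 3) (LocalRing L v)).val : Matrix (Fin 3) (Fin 3) (LocalRing L v)) + b • 1) *
        (b' • (((endoEmbLocal L v γH).val : GL (Fin 3) (LocalRing L v)).val : Matrix (Fin 3) (Fin 3) (LocalRing L v)) + a' • 1)⁻¹ := by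
  have e1 : (((endoEmbLocal L v γH').val : GL (Fin 3) (LocalRing L v)).val : Matrix (Fin 3) (Fin 3) (LocalRing L v)) =
      Matrix.reindex endoPerm endoPerm (Matrix.fromBlocks ((γH'.1.val : GL (Fin 2) (LocalRing L v)).val) 0 0 ((γH'.2.val : GL (Fin 1) (LocalRing L v)).val)) := by
    rw [coe_endoEmbLocal, coe_endoGL]
  have e0 : (((endoEmbLocal L v γH).val : GL (Fin 3) (LocalRing L v)).val : Matrix (Fin 3) (Fin 3) (LocalRing L v)) =
      Matrix.reindex endoPerm endoPerm (Matrix.fromBlocks ((γH.1.val : GL (Fin 2) (LocalRing L v)).val) 0 0 ((γH.2.val : GL (Fin 1) (LocalRing L v)).val)) := by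
    rw [coe_endoEmbLocal, coe_endoGL]
  rw [e1, e0, genMoebius_reindex, genMoebius_fromBlocks _ _ _ _ _ _ hD1 hD2, h1, h2]

/-- **Matching is kept, four scalars**: `ι_v(γ_H) ↔ δ ⇒ ι_v(γ_H′) ↔ δ′` when `ι_v(γ_H′) = φ(ι_v(γ_H))` and `δ′ = φ(δ)` as matrices for the same four scalars (★ P1 `moebius_conj'`;
★ `isLocalNormPair_of_coe_eq_moebius` is the σ-fixed pair). [cite: Rogawski1990, §4.9 p. 54; §14.1 p. 232] -/
theorem isLocalNormPair_of_coe_eq_genMoebius (H' : Matrix (Fin 3) (Fin 3) L)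
    (γH γH' : (cmDatum L 2 (Matrix.of fun i j : Fin 2 => if i.val + j.val + 1 = 2 then (1 : L) else 0)).Local v ×
      (cmDatum L 1 (Matrix.of fun i j : Fin 1 => if i.val + j.val + 1 = 1 then (1 : L) else 0)).Local v)
    (δ δ' : (cmDatum L 3 H').Local v) (a b a' b' : LocalRing L v) (h : IsLocalNormPair L H' v γH δ)
    (hι : (((endoEmbLocal L v γH').val : GL (Fin 3) (LocalRing L v)).val : Matrix (Fin 3) (Fin 3) (LocalRing L v)) =
      (a • (((endoEmbLocal L v γH).val : GL (Fin 3) (LocalRing L v)).val : Matrix (Fin 3) (Fin 3) (LocalRing L v)) + b • 1) *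
        (b' • (((endoEmbLocal L v γH).val : GL (Fin 3) (LocalRing L v)).val : Matrix (Fin 3) (Fin 3) (LocalRing L v)) + a' • 1)⁻¹)
    (hδ : ((δ'.val : GL (Fin 3) (LocalRing L v)).val : Matrix (Fin 3) (Fin 3) (LocalRing L v)) =
      (a • ((δ.val : GL (Fin 3) (LocalRing L v)).val : Matrix (Fin 3) (Fin 3) (LocalRing L v)) + b • 1) *
        (b' • ((δ.val : GL (Fin 3) (LocalRing L v)).val : Matrix (Fin 3) (Fin 3) (LocalRing L v)) + a' • 1)⁻¹)
    (hD : IsUnit (b' • (((endoEmbLocal L v γH).val : GL (Fin 3) (LocalRing L v)).val : Matrix (Fin 3) (Fin 3) (LocalRing L v)) + a' • (1 : Matrix (Fin 3) (Fin 3) (LocalRing L v))).det) :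
    IsLocalNormPair L H' v γH' δ' := by
  obtain ⟨x, hx⟩ := isConj_iff.1 h
  refine isConj_iff.2 ⟨x, Units.ext ?_⟩
  have hxm : ((δ.val : GL (Fin 3) (LocalRing L v)).val : Matrix (Fin 3) (Fin 3) (LocalRing L v)) =
      x.val * (((endoEmbLocal L v γH).val : GL (Fin 3) (LocalRing L v)).val : Matrix (Fin 3) (Fin 3) (LocalRing L v)) * x.val⁻¹ := by
    rw [← hx, Units.val_mul, Units.val_mul, Matrix.coe_units_inv]
    rfl
  rw [Units.val_mul, Units.val_mul, Matrix.coe_units_inv]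
  change x.val * (((endoEmbLocal L v γH').val : GL (Fin 3) (LocalRing L v)).val) * x.val⁻¹ =
    ((δ'.val : GL (Fin 3) (LocalRing L v)).val : Matrix (Fin 3) (Fin 3) (LocalRing L v))
  rw [hι, hδ, hxm, moebius_conj' _ _ (Matrix.isUnits_det_units x) _ _ _ _ hD]

/-- **`γ₂′ = φ(γ₂)` on the `U(Φ₁)`-coordinate, four scalars**: `finGammaTwo γ_H′ = (a u + b)·(b′ u + a′)⁻¹` (`Ring.inverse`), `u = finGammaTwo γ_H`.
[cite: Rogawski1990, §4.9 p. 55] -/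
theorem finGammaTwo_of_coe_eq_genMoebius
    (γH γH' : (cmDatum L 2 (Matrix.of fun i j : Fin 2 => if i.val + j.val + 1 = 2 then (1 : L) else 0)).Local v ×
      (cmDatum L 1 (Matrix.of fun i j : Fin 1 => if i.val + j.val + 1 = 1 then (1 : L) else 0)).Local v)
    (a b a' b' : LocalRing L v)
    (h2 : ((γH'.2.val : GL (Fin 1) (LocalRing L v)).val : Matrix (Fin 1) (Fin 1) (LocalRing L v)) =
      (a • ((γH.2.val : GL (Fin 1) (LocalRing L v)).val : Matrix (Fin 1) (Fin 1) (LocalRing L v)) + b • 1) *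
        (b' • ((γH.2.val : GL (Fin 1) (LocalRing L v)).val : Matrix (Fin 1) (Fin 1) (LocalRing L v)) + a' • 1)⁻¹) :
    finGammaTwo L v γH' = (a * finGammaTwo L v γH + b) * Ring.inverse (b' * finGammaTwo L v γH + a') := by
  unfold finGammaTwo
  rw [show (γH'.2.val.val : Matrix (Fin 1) (Fin 1) (LocalRing L v)) = ((γH'.2.val : GL (Fin 1) (LocalRing L v)).val : Matrix (Fin 1) (Fin 1) (LocalRing L v)) from rfl, h2,
    genMoebius_fin_one_apply]

/-- **κ IS KEPT, four scalars**: `κ_v(γ_H′, δ′) = κ_v(γ_H, δ)` — the `γ₂`-eigenvector `p′` of `δ` is the `γ₂′`-eigenvector of `δ′ = φ(δ)` (★ `genMoebius_mulVec_of_eigenvector_ring`)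
and `κ_v` is read on the `H′_v`-value of ANY such eigenvector (★ `finKappaAt_eq_ite_of_eigenvector`).  ★ `finKappaAt_of_coe_eq_moebius` is the σ-fixed pair.
[cite: Rogawski1990, §14.6 p. 242; §4.3 p. 43] [cite: LanglandsShelstad1987, §1.3–1.4] -/
theorem finKappaAt_of_coe_eq_genMoebius (H' : Matrix (Fin 3) (Fin 3) L) (w : PlacesOver L v) (hw : IsCMField.complexConj L • w.1 = w.1)
    (γH γH' : (cmDatum L 2 (Matrix.of fun i j : Fin 2 => if i.val + j.val + 1 = 2 then (1 : L) else 0)).Local v ×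
      (cmDatum L 1 (Matrix.of fun i j : Fin 1 => if i.val + j.val + 1 = 1 then (1 : L) else 0)).Local v)
    (δ δ' : (cmDatum L 3 H').Local v) (a b a' b' : LocalRing L v) (h : IsLocalNormPair L H' v γH δ) (h' : IsLocalNormPair L H' v γH' δ')
    (hreg : IsLocalGRegular L v γH) (hreg' : IsLocalGRegular L v γH')
    (hδ : ((δ'.val : GL (Fin 3) (LocalRing L v)).val : Matrix (Fin 3) (Fin 3) (LocalRing L v)) =
      (a • ((δ.val : GL (Fin 3) (LocalRing L v)).val : Matrix (Fin 3) (Fin 3) (LocalRing L v)) + b • 1) *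
        (b' • ((δ.val : GL (Fin 3) (LocalRing L v)).val : Matrix (Fin 3) (Fin 3) (LocalRing L v)) + a' • 1)⁻¹)
    (hu' : finGammaTwo L v γH' = (a * finGammaTwo L v γH + b) * Ring.inverse (b' * finGammaTwo L v γH + a'))
    (hDδ : IsUnit (b' • ((δ.val : GL (Fin 3) (LocalRing L v)).val : Matrix (Fin 3) (Fin 3) (LocalRing L v)) + a' • (1 : Matrix (Fin 3) (Fin 3) (LocalRing L v))).det)
    (hu : IsUnit (b' * finGammaTwo L v γH + a')) (hκ : finKappaAt L v H' γH δ ≠ 0) :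
    finKappaAt L v H' γH' δ' = finKappaAt L v H' γH δ := by
  have hv : Subsingleton (PlacesOver L v) := PlacesOver.subsingleton_of_smul_eq (IsCMField.complexConj L) (IsCMField.complexConj_ne_one L) w hw
  obtain ⟨p', hne, hp'⟩ := exists_eigenvector_of_finKappaAt_ne_zero L v H' γH δ h hκ
  have hu0 : IsUnit ((finCharpolyTwo L v γH).eval (finGammaTwo L v γH)) := isUnit_eval_finCharpolyTwo_of_isLocalGRegular L v γH hreg
  have hu0' : IsUnit ((finCharpolyTwo L v γH').eval (finGammaTwo L v γH')) := isUnit_eval_finCharpolyTwo_of_isLocalGRegular L v γH' hreg'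
  have hp'' : ((δ'.val.val : Matrix (Fin 3) (Fin 3) (LocalRing L v))) *ᵥ p' = finGammaTwo L v γH' • p' := by
    rw [show (δ'.val.val : Matrix (Fin 3) (Fin 3) (LocalRing L v)) = ((δ'.val : GL (Fin 3) (LocalRing L v)).val : Matrix (Fin 3) (Fin 3) (LocalRing L v)) from rfl, hδ, hu',
      genMoebius_mulVec_of_eigenvector_ring hp' a b a' b' hu hDδ]
  rw [finKappaAt_eq_ite_of_eigenvector L v H' γH' δ' hv h' hu0' hp'' hne, finKappaAt_eq_ite_of_eigenvector L v H' γH δ hv h hu0 hp' hne]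

end Carriers

end Literature.NumberTheory.Rogawski1990

end
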